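import Literature.Geometry.Riemannian.RicciFlowShiEstimates
import Literature.Geometry.Riemannian.ShiDerivativeMaxPrinciple
import Literature.Geometry.Riemannian.CurvatureDerivativeNormSq
import Literature.Geometry.Riemannian.CurvatureNormSq
import Literature.Geometry.Riemannian.RicciFlowMaximal
import HarnessLib

/-!
# Scaled Shi estimates for a Type-I Ricci flow near its final time
(stub `stub_scaledShi` of line `margerin-cone-hamilton-rails`, crux
`EntropyRung.ChangGurskyYang`, item stmt-SmoothPoincare4-10834)

Shi's global derivative estimates (Topping 2006, Thm. 3.3.1; Hamilton 1982, §13) in SCALED form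
for ONE Ricci flow `(g, cov)` of Riemannian metrics on `[0, T)` on a closed 4-manifold with a
Type-I curvature bound `|Rm|² ≤ C₀ (T − t)⁻²` on `[t₀, T)`: for every `k` there are `C` and
`t₁ ∈ [0, T)` with `|∇ᵏRm|² ≤ C (T − t)^{−k−2}` on `M × [t₁, T)`.

Proof. The tree provides the two halves of Thm. 3.3.1:
* the evolution inequalities `∂ₜ U_j ≤ Δ U_j − 2 U_{j+1} + C_j (Σ_{i ≤ j} √U_i √U_{j−i}) √U_j
  + C_j √U_0 U_j` for `U_j = |∇ʲRm|²` (`curvDerivNormSq`) with ONE constant `C_j` for all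
  `t ∈ [0, T)` (`IsRicciFlow.derivWithin_curvDerivNormSq_le`); the extra term `√U_0 U_j` is the
  `i = 0` summand `√U_0 √U_j √U_j`, so the inequalities take the abstract shape of
  `shi_maxPrinciple_bound` with the constants `2 C_j` (`shi_constants_of_isRicciFlow`);
* the quantitative maximum principle on a window `[a, b]` (`shi_maxPrinciple_bound_Icc`): if
  `U_0 ≤ M₀²` on the window and `M₀ (b − a) ≤ 1` then `(b − a)^k U_k(b, ·) ≤ shiConst C k · M₀²`
  (`shi_window_bound_of_isRicciFlow`; the time derivative within the window agrees with the one
  within `[0, T)`, `derivWithin_subset`, exactly as in `shi_maxPrinciple_bound_near_end`).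
With `C₁ = max C₀ 1`, `t₁ = (T + t₀)/2` and, for `t ∈ [t₁, T)`, the shrinking window
`[t − (T − t)/C₁, t] ⊆ [t₀, T)` on which `|Rm|² ≤ C₁ (T − s)⁻² ≤ C₁² (T − t)⁻² = M₀²`,
`M₀ = C₁/(T − t)`, `M₀ · (T − t)/C₁ = 1`, one gets
`((T − t)/C₁)^k U_k(t, ·) ≤ shiConst C k · C₁² (T − t)⁻²`, i.e.
`U_k(t, ·) ≤ shiConst C k · C₁^{k+2} · (T − t)^{−k−2}`. No uniformity across different flows is
used: the per-flow constants `C_j` are uniform in time and `shiConst` is universal.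

## References

* P. Topping, *Lectures on the Ricci flow*, LMS Lecture Note Series 325, CUP 2006, §3.3:
  Thm. 3.3.1 with its proof, Cor. 3.3.2 (pp. 37–39). [Topping2006]
* R. S. Hamilton, *Three-manifolds with positive Ricci curvature*, J. Differential Geom. 17
  (1982) 255–306, §13 (Thm. 13.4 ff.), §14 (Lemma 14.4). [Hamilton1982]
* R. S. Hamilton, *Four-manifolds with positive curvature operator*, J. Differential Geom. 24
  (1986) 153–179, §5. [Hamilton1986]
-/

noncomputable section

-- every `Summit.SmoothPoincare4.SmoothPoincare4.…` name repeats the summit = sub-problem segment (D-0017 layout)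
set_option linter.dupNamespace false

open Set Function Filter
open scoped Manifold ContDiff Topology

namespace Summit.SmoothPoincare4.SmoothPoincare4.Theorems.MargerinRails

open Literature.Geometry.Riemannian
open Literature.Geometry.Lorentzian Literature.Geometry.Lorentzian.PseudoRiemannianMetric

section General

variable {E : Type*} [NormedAddCommGroup E] [NormedSpace ℝ E] [FiniteDimensional ℝ E]
  [CompleteSpace E] {H : Type*} [TopologicalSpace H] {I : ModelWithCorners ℝ E H} [I.Boundaryless]
  {M : Type*} [TopologicalSpace M] [ChartedSpace H M] [IsManifold I ∞ M] [CompactSpace M]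
  {g : ℝ → PseudoRiemannianMetric I ∞ E (TangentSpace I : M → Type _)}
  {cov : ℝ → CovariantDerivative I E (TangentSpace I : M → Type _)} {T : ℝ}

/-- **The evolution inequalities (3.3.4) of all orders in the shape of the maximum-principle
half of Thm. 3.3.1**: along a Ricci flow of Riemannian metrics on `[0, T)`, `T > 0`, on a closed
manifold there is ONE sequence of constants `C_j ≥ 0` with
`∂ₜ U_j ≤ Δ U_j − 2 U_{j+1} + C_j Σ_{i ≤ j} √U_i √U_{j−i} √U_j` at every `t ∈ [0, T)`,
`U_j = curvDerivNormSq I g j` (the term `C √U_0 U_j` of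
`IsRicciFlow.derivWithin_curvDerivNormSq_le` is the `i = 0` summand, so it is absorbed by
doubling the constant). [cite: Topping2006, §3.3, (3.3.4)] -/
theorem shi_constants_of_isRicciFlow (hflow : IsRicciFlow g cov (Ico 0 T)) (hT : 0 < T)
    (hR : ∀ s ∈ Ico 0 T, (g s).IsRiemannian) :
    ∃ C : ℕ → ℝ, (∀ j, 0 ≤ C j) ∧ ∀ j, ∀ t ∈ Ico 0 T, ∀ z : M,
      derivWithin (fun s ↦ curvDerivNormSq I g j s z) (Ico 0 T) t ≤
        (g t).laplaceBeltrami (curvDerivNormSq I g j t) z - 2 * curvDerivNormSq I g (j + 1) t z +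
          C j * ∑ i ∈ Finset.range (j + 1), Real.sqrt (curvDerivNormSq I g i t z) *
            Real.sqrt (curvDerivNormSq I g (j - i) t z) *
              Real.sqrt (curvDerivNormSq I g j t z) := by
  have hS : UniqueDiffOn ℝ (Ico 0 T) := uniqueDiffOn_Ico 0 T
  have hS' := Ico_subset_closure_interior hT
  have h0 : (0 : ℝ) ∈ Ico 0 T := ⟨le_rfl, hT⟩
  choose C hC0 hC using fun j ↦ hflow.derivWithin_curvDerivNormSq_le hS hS' hR h0 j
  refine ⟨fun j ↦ 2 * C j, fun j ↦ mul_nonneg zero_le_two (hC0 j), fun j t ht z ↦ ?_⟩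
  have h := hC j t ht z
  -- abbreviations: `u i = U_i(t, z)`, `F i` the summands of the abstract shape
  set u : ℕ → ℝ := fun i ↦ curvDerivNormSq I g i t z with hu
  have hnn : ∀ i, 0 ≤ u i := fun i ↦ curvDerivNormSq_nonneg (hR t ht) i z
  set F : ℕ → ℝ := fun i ↦ Real.sqrt (u i) * Real.sqrt (u (j - i)) * Real.sqrt (u j) with hF
  have hFnn : ∀ i, 0 ≤ F i := fun i ↦
    mul_nonneg (mul_nonneg (Real.sqrt_nonneg _) (Real.sqrt_nonneg _)) (Real.sqrt_nonneg _)
  -- the sum of the abstract shape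
  have hsum : (∑ i ∈ Finset.range (j + 1), Real.sqrt (u i) * Real.sqrt (u (j - i)))
      * Real.sqrt (u j) = ∑ i ∈ Finset.range (j + 1), F i :=
    Finset.sum_mul _ _ _
  -- the extra term is the `i = 0` summand
  have hterm : Real.sqrt (u 0) * u j ≤ ∑ i ∈ Finset.range (j + 1), F i := by
    have h1 : Real.sqrt (u 0) * u j = F 0 := by
      rw [hF]
      dsimp only
      rw [Nat.sub_zero, mul_assoc, Real.mul_self_sqrt (hnn j)]
    rw [h1]
    exact Finset.single_le_sum (f := F) (fun i _ ↦ hFnn i) (Finset.mem_range.mpr (Nat.succ_pos j))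
  have e1 : C j * (∑ i ∈ Finset.range (j + 1), Real.sqrt (u i) * Real.sqrt (u (j - i)))
      * Real.sqrt (u j) = C j * ∑ i ∈ Finset.range (j + 1), F i := by
    rw [mul_assoc, hsum]
  have e2 : C j * Real.sqrt (u 0) * u j ≤ C j * ∑ i ∈ Finset.range (j + 1), F i := by
    rw [mul_assoc]
    exact mul_le_mul_of_nonneg_left hterm (hC0 j)
  show derivWithin (fun s ↦ curvDerivNormSq I g j s z) (Ico 0 T) t ≤
    (g t).laplaceBeltrami (curvDerivNormSq I g j t) z - 2 * u (j + 1) +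
      2 * C j * ∑ i ∈ Finset.range (j + 1), F i
  have h' : derivWithin (fun s ↦ curvDerivNormSq I g j s z) (Ico 0 T) t ≤
      (g t).laplaceBeltrami (curvDerivNormSq I g j t) z - 2 * u (j + 1) +
        C j * (∑ i ∈ Finset.range (j + 1), Real.sqrt (u i) * Real.sqrt (u (j - i)))
          * Real.sqrt (u j) + C j * Real.sqrt (u 0) * u j := h
  linarith only [h', e1, e2]

/-- **Thm. 3.3.1 (maximum-principle half) on a window `[a, b] ⊆ [0, T)` of a Ricci flow**: with
the constants `C` of `shi_constants_of_isRicciFlow`, if `U_0 ≤ M₀²` on `M × [a, b]` and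
`M₀ (b − a) ≤ 1` then `(b − a)^k U_k(b, ·) ≤ shiConst C k · M₀²` (`shi_maxPrinciple_bound_Icc`;
the time derivative within `[a, b]` is the one within `[0, T)`, `derivWithin_subset`).
[cite: Topping2006, Thm. 3.3.1] -/
theorem shi_window_bound_of_isRicciFlow (hflow : IsRicciFlow g cov (Ico 0 T)) (hT : 0 < T)
    (hR : ∀ s ∈ Ico 0 T, (g s).IsRiemannian) {C : ℕ → ℝ} (hC0 : ∀ j, 0 ≤ C j)
    (hC : ∀ j, ∀ t ∈ Ico 0 T, ∀ z : M,
      derivWithin (fun s ↦ curvDerivNormSq I g j s z) (Ico 0 T) t ≤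
        (g t).laplaceBeltrami (curvDerivNormSq I g j t) z - 2 * curvDerivNormSq I g (j + 1) t z +
          C j * ∑ i ∈ Finset.range (j + 1), Real.sqrt (curvDerivNormSq I g i t z) *
            Real.sqrt (curvDerivNormSq I g (j - i) t z) * Real.sqrt (curvDerivNormSq I g j t z))
    {a b M₀ : ℝ} (hab : a < b) (hsub : Icc a b ⊆ Ico 0 T) (hM₀ : 0 < M₀)
    (hτM : M₀ * (b - a) ≤ 1) (h0 : ∀ s ∈ Icc a b, ∀ x : M, curvDerivNormSq I g 0 s x ≤ M₀ ^ 2)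
    (k : ℕ) (x : M) :
    (b - a) ^ k * curvDerivNormSq I g k b x ≤ shiConst C k * M₀ ^ 2 := by
  have hS : UniqueDiffOn ℝ (Ico 0 T) := uniqueDiffOn_Ico 0 T
  have hS' := Ico_subset_closure_interior hT
  have hf : ∀ j, ContMDiffOn (I.prod 𝓘(ℝ, ℝ)) 𝓘(ℝ, ℝ) ∞
      (fun p : M × ℝ ↦ curvDerivNormSq I g j p.2 p.1) (univ ×ˢ Icc a b) := fun j ↦
    (hflow.contMDiffOn_curvDerivNormSq hS hS' hR j).mono (prod_mono Subset.rfl hsub)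
  have hev : ∀ j, ∀ s ∈ Icc a b, ∀ y : M,
      derivWithin (fun r ↦ curvDerivNormSq I g j r y) (Icc a b) s ≤
        (g s).laplaceBeltrami (curvDerivNormSq I g j s) y - 2 * curvDerivNormSq I g (j + 1) s y +
          C j * ∑ i ∈ Finset.range (j + 1), Real.sqrt (curvDerivNormSq I g i s y) *
            Real.sqrt (curvDerivNormSq I g (j - i) s y) *
              Real.sqrt (curvDerivNormSq I g j s y) := by
    intro j s hs y
    have hsT : s ∈ Ico 0 T := hsub hs
    have hdiff : DifferentiableWithinAt ℝ (fun r ↦ curvDerivNormSq I g j r y) (Ico 0 T) s :=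
      (hflow.hasDerivWithinAt_curvDerivNormSq hS hS' hR j y hsT).differentiableWithinAt
    rw [derivWithin_subset hsub (uniqueDiffOn_Icc hab s hs) hdiff]
    exact hC j s hsT y
  exact shi_maxPrinciple_bound_Icc (g := g) (f := fun j s y ↦ curvDerivNormSq I g j s y) hab
    (fun s hs ↦ hR s (hsub hs)) hf (fun j s hs y ↦ curvDerivNormSq_nonneg (hR s (hsub hs)) j y)
    hM₀ hτM h0 hC0 hev k b ⟨hab.le, le_rfl⟩ x

end General

/-- **STUB 4.B4 — SCALED SHI ESTIMATES FOR ONE TYPE-I FLOW (Topping 2006, Thm. 3.3.1; Hamilton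
1982, §13, Thm. 13.4 and §14, Lemma 14.4).** Along a Ricci flow of Riemannian metrics on `[0, T)`,
`T > 0`, on a closed 4-manifold with `|Rm|² ≤ C₀ (T − t)⁻²` on `[t₀, T)`, for every `k` there are
`C` and `t₁ ∈ [0, T)` with `|∇ᵏRm|² ≤ C (T − t)^{−k−2}` on `M × [t₁, T)`: the maximum-principle
half of Thm. 3.3.1 (`shi_window_bound_of_isRicciFlow`) on the shrinking windows
`[t − (T − t)/C₁, t] ⊆ [t₀, T)`, `C₁ = max C₀ 1`, `t ≥ t₁ = (T + t₀)/2`, with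
`M₀ = C₁/(T − t)` (`|Rm|² ≤ C₁ (T − s)⁻² ≤ C₁² (T − t)⁻²` on the window); output constant
`shiConst C k · C₁^{k+2}`. [cite: Topping2006, §3.3, Thm. 3.3.1]
[cite: Hamilton1982, §13, Thm. 13.4 and §14, Lemma 14.4] -/
theorem stub_scaledShi :
    ∀ (M : Type) [TopologicalSpace M] [T2Space M] [SecondCountableTopology M]
      [ChartedSpace (EuclideanSpace ℝ (Fin 4)) M] [IsManifold (𝓡 4) ∞ M] [CompactSpace M]
      (g : ℝ → PseudoRiemannianMetric (𝓡 4) ∞ (EuclideanSpace ℝ (Fin 4)) (TangentSpace (𝓡 4) : M → Type _))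
      (cov : ℝ → CovariantDerivative (𝓡 4) (EuclideanSpace ℝ (Fin 4)) (TangentSpace (𝓡 4) : M → Type _))
      (T : ℝ), 0 < T → IsRicciFlow g cov (Ico 0 T) → (∀ t ∈ Ico 0 T, (g t).IsRiemannian) →
      ∀ (C₀ t₀ : ℝ), t₀ ∈ Ico 0 T →
      (∀ t ∈ Ico t₀ T, ∀ x : M, (g t).curvNormSqWith (cov t) x ≤ C₀ * ((T - t) ^ 2)⁻¹) →
      ∀ k : ℕ, ∃ C t₁ : ℝ, t₁ ∈ Ico 0 T ∧ ∀ t ∈ Ico t₁ T, ∀ z : M,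
        curvDerivNormSq (𝓡 4) g k t z ≤ C * ((T - t) ^ (k + 2))⁻¹ := by
  intro M _ _ _ _ _ _ g cov T hT hflow hR C₀ t₀ ht₀ hbd k
  obtain ⟨C, hC0, hC⟩ := shi_constants_of_isRicciFlow hflow hT hR
  -- the constants
  set C₁ : ℝ := max C₀ 1 with hC₁
  have hC₁1 : 1 ≤ C₁ := le_max_right _ _
  have hC₁0 : 0 < C₁ := one_pos.trans_le hC₁1
  have hbd' : ∀ t ∈ Ico t₀ T, ∀ x : M, curvDerivNormSq (𝓡 4) g 0 t x ≤ C₁ * ((T - t) ^ 2)⁻¹ := by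
    intro t ht x
    have htT : t ∈ Ico 0 T := ⟨ht₀.1.trans ht.1, ht.2⟩
    rw [curvDerivNormSq_zero_eq (hR t htT) (hflow.isLeviCivita t htT)]
    exact (hbd t ht x).trans
      (mul_le_mul_of_nonneg_right (le_max_left _ _) (inv_nonneg.2 (sq_nonneg _)))
  refine ⟨shiConst C k * C₁ ^ (k + 2), (T + t₀) / 2, ⟨by linarith [ht₀.1], by linarith [ht₀.2]⟩,
    fun t ht z ↦ ?_⟩
  -- the window `[a, t]`, `a = t - (T - t)/C₁`
  have htT : t < T := ht.2
  have hTt : 0 < T - t := sub_pos.2 htT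
  have hτ0 : 0 < (T - t) / C₁ := div_pos hTt hC₁0
  have hτle : (T - t) / C₁ ≤ T - t := div_le_self hTt.le hC₁1
  have hat : t - (T - t) / C₁ < t := by linarith
  have ht₀a : t₀ ≤ t - (T - t) / C₁ := by
    have h₁ : (T + t₀) / 2 ≤ t := ht.1
    linarith
  have hsub : Icc (t - (T - t) / C₁) t ⊆ Ico 0 T := fun s hs ↦
    ⟨ht₀.1.trans (ht₀a.trans hs.1), hs.2.trans_lt htT⟩
  -- `M₀ = C₁ / (T - t)`
  have hM₀ : 0 < C₁ * (T - t)⁻¹ := mul_pos hC₁0 (inv_pos.2 hTt)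
  have hτM : C₁ * (T - t)⁻¹ * (t - (t - (T - t) / C₁)) ≤ 1 := by
    rw [sub_sub_cancel]
    field_simp
    rfl
  have h0 : ∀ s ∈ Icc (t - (T - t) / C₁) t, ∀ x : M,
      curvDerivNormSq (𝓡 4) g 0 s x ≤ (C₁ * (T - t)⁻¹) ^ 2 := by
    intro s hs x
    have hs' : s ∈ Ico t₀ T := ⟨ht₀a.trans hs.1, hs.2.trans_lt htT⟩
    refine (hbd' s hs' x).trans ?_
    have h₁ : ((T - s) ^ 2)⁻¹ ≤ ((T - t) ^ 2)⁻¹ :=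
      inv_anti₀ (pow_pos hTt 2) (pow_le_pow_left₀ hTt.le (by linarith [hs.2]) 2)
    have h₂ : C₁ ≤ C₁ ^ 2 := by nlinarith
    rw [mul_pow, inv_pow]
    exact mul_le_mul h₂ h₁ (inv_nonneg.2 (sq_nonneg _)) (sq_nonneg _)
  have hb := shi_window_bound_of_isRicciFlow hflow hT hR hC0 hC hat hsub hM₀ hτM h0 k z
  rw [sub_sub_cancel] at hb
  have hb' := (le_div_iff₀' (pow_pos hτ0 k)).2 hb
  refine hb'.trans (le_of_eq ?_)
  rw [div_pow, mul_pow, inv_pow, pow_add, pow_add]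
  field_simp

end Summit.SmoothPoincare4.SmoothPoincare4.Theorems.MargerinRails

end
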